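import Literature.InformationTheory.QuantumCodes.SubsystemCodes
import Literature.InformationTheory.QuantumCodes.LocalCodeDistanceBound
import HarnessLib

/-!
# Bravyi–Terhal 2009, Theorem 3: `d ≤ 3r·L^{D−1}` for subsystem codes with local GAUGE generators — proof

S. Bravyi, B. Terhal, arXiv:0810.1983 [BravyiTerhal2009]. §1.3 (chunk p0007 L88–100): «The example of the
Bacon-Shor code demonstrates that some subsystem codes with local generators originate from subspace codes with
highly non-local stabilizer groups. It might suggest that subsystem codes can beat the upper bound Eq. (2). We will
show that this intuition is wrong by proving Theorem 3. Let `𝒢 = ⟨G_1,…,G_m⟩` be the gauge group of a subsystem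
stabilizer code on a `D`-dimensional lattice `Λ = {1,…,L}^D`. Suppose the support of any generator `G_a` can be bounded
by a hypercube with `r^D` vertices. Then the distance of `𝒢` satisfies `d ≤ 3r L^{D−1}`.» §3.1 Lemma 3 (p0011 L59–103):
«(Restriction Lemma) … Let `M ⊆ Λ` be an arbitrary subset and `∂M` be [the] vertices `u ∈ Λ∖M` such that
`l_∞`-distance between `u` and `M` is at most `r`. Consider the subsystem code with gauge group `𝒢_M`. Then one of
the following is true: (1) The code `𝒢_M` has no logical qubits, (2) The code `𝒢_M` has distance at least
`d − |∂M|` … Proof. … `P ∈ 𝒞(𝒢_M) ∩ 𝒫(M)`, `P ∉ 𝒢_M` and a gauge operator `G ∈ 𝒢_M` such that `|PG| = d'` … we can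
extend the operator `G ∈ 𝒢_M` beyond `M` to some gauge operator `G' ∈ 𝒢` … Since `𝒢` has local generators, such an
operator `G'` can be chosen to have support only in `M` and in `∂M`. It means that `|PG'| ≤ d' + |∂M|`.» Proof of
Thm. 3 (p0011 L105–p0012 L40, `D = 1` with «generalization to higher dimensions … straightforward … we would
consider the minimal width strips `M`»): «Let `M ⊆ Λ` be the smallest contiguous block of qubits such that the
subsystem code `𝒢_M` obtained by restricting `𝒢` onto `M` has at least one logical qubit … partition `M` into three
contiguous blocks, `M = ABC`, such that `|B| = r−1` and `A, C ≠ ∅`. Let `P, Q ∈ 𝒞(𝒢_M)∖𝒢_M` be any pair of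
anti-commuting logical operators … apply Lemma 2 to the code `𝒢_M` to clean out the region `B` … `P = P_A P_C`,
`Q = Q_A Q_C` … Assume … `P_A` anti-commutes with `Q_A` … no generator of `𝒢_M` overlaps with both `A` and `C`.
Therefore … `P_A, Q_A ∈ 𝒞(𝒢_M)` … `P_A, Q_A ∈ 𝒞(𝒢_A)∖𝒢_A` … contradicts the minimality of `M`.»

THIS FILE PROVES Theorem 3 in the tree's symplectic picture, open boundary conditions, every `D ≥ 1` and `L`:
`BravyiTerhal2009_theorem3 : 1 ≤ D → 1 ≤ r → HasLocalGenerators e r Ḡ → IsSubsystemCode Ḡ k d → 1 ≤ k → d ≤ 3·r·L^{D−1}`.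
The restricted code `𝒢_M` is `Ḡ.map ρ_M` (`restrictGauge`); «`𝒢_M` has at least one logical qubit» is used in the
equivalent symplectic form «`Ḡ⊥ ∩ 𝒫(M)` contains an anticommuting pair» (`HasLogicalPairOn`: the bare logical
operators of `𝒢_M` inside `M` are exactly `Ḡ⊥ ∩ 𝒫(M)`, and a subspace of the symplectic space `𝒫(M)` carries a
logical qubit iff it is not isotropic). Steps: the whole lattice has such a pair when `k ≥ 1`
(`hasLogicalPairOn_univ`); a pair on `M` gives `d ≤ |M|` (`dist_le_card_of_pair`); the Restriction Lemma in the
form «a dressed logical operator `R` of `𝒢_M` inside `M` extends to a dressed logical operator of `𝒢` supported on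
`supp R ∪ ∂M`» (`exists_dressed_extension`); the cleaning of `B` inside `𝒢_M` by the subsystem Cleaning Lemma of
`SubsystemCodes.lean`; the splitting `P' = P_A + P_C` across the gap `B` of width `r − 1`; minimality via `Nat.find`
over strip widths.

Deliberately NOT here: periodic boundary conditions («straightforward» in the source; not typed), the energy
barrier of subsystem Hamiltonians (§3.2, only `d‡ = O(d)`).

## Mathlib / tree search

Tree: `gaugeStabilizer`, `IsSubsystemCode`, `IsGaugeCorrectable`, `sympDual_gaugeStabilizer` (useful identity),
`sup_gaugeStabilizer_bare_compl_eq`, `gaugeStabilizer_le`, `gaugeStabilizer_le_sympDual`,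
`isSelfOrthogonal_gaugeStabilizer`, `le_sympDual_gaugeStabilizer` (SubsystemCodes.lean); `proj`, `proj_apply_fst/snd`,
`proj_mem_supportedOn`, `proj_add_proj_compl`, `sympInner_proj_right`, `sympInner_eq_zero_of_supportedOn_compl`,
`sympWeight_le_card_of_mem` (QuantumSingletonBound.lean); `mem_supportedOn_of_forall_sympSupport`
(CorrectableRegions.lean); `card_filter_apply_zero_mem` (LocalCodeDistanceBound.lean); `IsCubeLocal`, `InCube`,
`HasLocalGenerators`, `sympSupport` (LocalityBounds.lean); Mathlib `Submodule.mem_span_range_iff_exists_fun`.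
-/

namespace Literature.InformationTheory.QuantumCodes

open Finset Module
open Classical

variable {n : ℕ}

namespace GaugeRestrict

/-! ### Restricted gauge space and logical pairs -/

/-- **The restricted code `𝒢_M`**: restrictions to `M` of the gauge operators, `Ḡ_M = ρ_M(Ḡ)`. Column: definition.
[cite: BravyiTerhal2009, §3.1 Lemma 3 («the subsystem code with gauge group 𝒢_M … regarded as a code defined on qubits of M only»)] -/
def restrictGauge (G : Submodule (ZMod 2) (SympVec n)) (M : Finset (Fin n)) : Submodule (ZMod 2) (SympVec n) :=
  G.map (proj M)

/-- **«`𝒢_M` has at least one logical qubit»**, symplectically: `Ḡ⊥ ∩ 𝒫(M)` (the bare logical operators of `𝒢_M`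
inside `M`) contains an anticommuting pair. Column: definition.
[cite: BravyiTerhal2009, §3.1 proof of Thm. 3 («Let P, Q ∈ 𝒞(𝒢_M)∖𝒢_M be any pair of anti-commuting logical operators for the code 𝒢_M»)] -/
def HasLogicalPairOn (G : Submodule (ZMod 2) (SympVec n)) (M : Finset (Fin n)) : Prop :=
  ∃ P ∈ sympDual G, P ∈ supportedOn M ∧ ∃ Q ∈ sympDual G, Q ∈ supportedOn M ∧ sympInner P Q ≠ 0

variable {G : Submodule (ZMod 2) (SympVec n)} {M : Finset (Fin n)}

/-- `Ḡ_M` is supported on `M`. [cite: BravyiTerhal2009, §3.1 Lemma 3 (𝒢_M on the qubits of M)] -/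
theorem restrictGauge_le_supportedOn : restrictGauge G M ≤ supportedOn M := by
  rintro _ ⟨g, -, rfl⟩
  exact proj_mem_supportedOn M g

/-- An operator supported on `M` commutes with `Ḡ_M` iff it commutes with `Ḡ`: `(Ḡ_M)⊥ ∩ 𝒫(M) = Ḡ⊥ ∩ 𝒫(M)`.
[cite: BravyiTerhal2009, §3.1 proof of Lemma 3 («P ∈ 𝒞(𝒢_M) ∩ 𝒫(M) … Then P ∈ 𝒞(𝒢)»)] -/
theorem mem_sympDual_restrictGauge_iff {P : SympVec n} (hP : P ∈ supportedOn M) :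
    P ∈ sympDual (restrictGauge G M) ↔ P ∈ sympDual G := by
  rw [mem_sympDual_iff, mem_sympDual_iff]
  constructor
  · intro h g hg
    have h1 := h (proj M g) ⟨g, hg, rfl⟩
    rwa [sympInner_comm, sympInner_proj_right hP, sympInner_comm] at h1
  · rintro h _ ⟨g, hg, rfl⟩
    rw [sympInner_comm, sympInner_proj_right hP, sympInner_comm]
    exact h g hg

/-- A logical pair forces a dressed logical operator on `M`: `d ≤ |M|`.
[cite: BravyiTerhal2009, §3.1 proof of Lemma 3 («P ∈ 𝒞(𝒢)∖𝒢, that is, P is a non-trivial logical operator for the original code»)] -/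
theorem dist_le_card_of_pair {d : ℕ} (hd : HasSubsystemMinDist G d) (h : HasLogicalPairOn G M) : d ≤ #M := by
  obtain ⟨P, hPd, hPM, Q, hQd, -, hPQ⟩ := h
  have hPG : P ∉ G := fun hPG => hPQ ((mem_sympDual_iff.1 hQd) P hPG)
  exact (hd P (sympDual_le_sympDual_gaugeStabilizer G hPd) hPG).trans (sympWeight_le_card_of_mem hPM)

/-- A code with `k ≥ 1` logical qubits has a logical pair on the whole lattice (`Ḡ⊥` is not isotropic, else
`Ḡ⊥ ≤ Ḡ⊥⊥ = Ḡ`). [cite: BravyiTerhal2009, §1.3 (𝒞(𝒢) = ⟨𝒮, X̄_j, Z̄_j⟩: anticommuting logical pairs when k ≥ 1)] -/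
theorem hasLogicalPairOn_univ {k d : ℕ} (hcode : IsSubsystemCode G k d) (hk : 1 ≤ k) :
    HasLogicalPairOn G (univ : Finset (Fin n)) := by
  by_contra hnone
  have hiso : sympDual G ≤ sympDual (sympDual G) := by
    intro P hP
    rw [mem_sympDual_iff]
    intro Q hQ
    by_contra hne
    exact hnone ⟨Q, hQ, fun i hi => absurd (mem_univ i) hi, P, hP, fun i hi => absurd (mem_univ i) hi, hne⟩
  rw [sympDual_sympDual] at hiso
  have hSe : gaugeStabilizer G = sympDual G := inf_eq_right.2 hiso
  have hdim := hcode.1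
  rw [hSe] at hdim
  omega

/-! ### The Restriction Lemma -/

/-- **Bravyi–Terhal Lemma 3 (Restriction Lemma), symplectic form — proved.** Let `Ḡ = ⟨γ⟩` and let `∂M` contain
every qubit outside `M` lying in the support of a generator that meets `M`. A dressed logical operator `R` of the
restricted code `𝒢_M` inside `M` (`R ∈ 𝒫(M)`, `R` commutes with the stabilizers of `Ḡ_M`, `R ∉ Ḡ_M`) extends to a
dressed logical operator `R̄ ∈ S̄⊥ ∖ Ḡ` of the original code supported on `supp R ∪ ∂M` («we can extend the operator
`G ∈ 𝒢_M` beyond `M` to some gauge operator `G' ∈ 𝒢` … chosen to have support only in `M` and in `∂M` …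
`|PG'| ≤ d' + |∂M|`»). Column: proved theorem. [cite: BravyiTerhal2009, §3.1 Lemma 3 (p. 11)] -/
theorem exists_dressed_extension {ι : Type*} [Fintype ι] (γ : ι → SympVec n)
    (hG : G = Submodule.span (ZMod 2) (Set.range γ)) {B : Finset (Fin n)}
    (hB : ∀ a, (∃ q ∈ sympSupport (γ a), q ∈ M) → ∀ q ∈ sympSupport (γ a), q ∉ M → q ∈ B)
    {R : SympVec n} (hRM : R ∈ supportedOn M) (hRd : R ∈ sympDual (gaugeStabilizer (restrictGauge G M)))
    (hRG : R ∉ restrictGauge G M) :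
    ∃ R' ∈ sympDual (gaugeStabilizer G), R' ∉ G ∧
      R' ∈ supportedOn (univ.filter fun q => (R.1 q ≠ 0 ∨ R.2 q ≠ 0) ∨ q ∈ B) := by
  -- R = z + y with z ∈ Ḡ_M, y bare for Ḡ_M
  rw [sympDual_gaugeStabilizer] at hRd
  obtain ⟨z, hz, y, hy, rfl⟩ := Submodule.mem_sup.1 hRd
  have hzM : z ∈ supportedOn M := restrictGauge_le_supportedOn hz
  have hyM : y ∈ supportedOn M := by
    have := (supportedOn M).sub_mem hRM hzM
    simpa using this
  have hyd : y ∈ sympDual G := (mem_sympDual_restrictGauge_iff hyM).1 hy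
  -- z = ρ_M g with g a combination of generators; keep only the generators meeting M
  obtain ⟨g, hg, hgz⟩ := hz
  have hgspan : g ∈ Submodule.span (ZMod 2) (Set.range γ) := by rw [← hG]; exact hg
  rw [Submodule.mem_span_range_iff_exists_fun] at hgspan
  obtain ⟨c, rfl⟩ := hgspan
  let γ' : ι → SympVec n := fun a => if ∃ q ∈ sympSupport (γ a), q ∈ M then γ a else 0
  set g' : SympVec n := ∑ a, c a • γ' a with hg'
  have hg'G : g' ∈ G := by
    rw [hG]
    refine Submodule.sum_mem _ fun a _ => Submodule.smul_mem _ _ ?_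
    dsimp only [γ']
    split_ifs
    · exact Submodule.subset_span ⟨a, rfl⟩
    · exact Submodule.zero_mem _
  have hproj : ∀ a, proj M (γ' a) = proj M (γ a) := by
    intro a
    dsimp only [γ']
    split_ifs with h
    · rfl
    · push Not at h
      rw [map_zero]
      symm
      ext i
      · simp only [proj_apply_fst, Prod.fst_zero, Pi.zero_apply]
        split_ifs with hi
        · by_contra hne
          exact h i (by simp [sympSupport, hne]) hi
        · rfl
      · simp only [proj_apply_snd, Prod.snd_zero, Pi.zero_apply]
        split_ifs with hi
        · by_contra hne
          exact h i (by simp [sympSupport, hne]) hi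
        · rfl
  have hzg' : proj M g' = z := by
    rw [← hgz, hg', map_sum, map_sum]
    refine Finset.sum_congr rfl fun a _ => ?_
    rw [map_smul, map_smul, hproj a]
  -- g' is supported on M ∪ B
  have hg'supp : g' ∈ supportedOn (M ∪ B) := by
    rw [hg']
    refine Submodule.sum_mem _ fun a _ => Submodule.smul_mem _ _ ?_
    dsimp only [γ']
    split_ifs with h
    · refine mem_supportedOn_of_forall_sympSupport fun q hq => ?_
      rw [mem_union]
      by_cases hqM : q ∈ M
      · exact Or.inl hqM
      · exact Or.inr (hB a h q hq hqM)
    · exact Submodule.zero_mem _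
  -- R' = y + g' = (z + y) + ρ_{M̄} g'
  refine ⟨y + g', ?_, ?_, ?_⟩
  · rw [sympDual_gaugeStabilizer]
    exact Submodule.add_mem _ (Submodule.mem_sup_right hyd) (Submodule.mem_sup_left hg'G)
  · intro hin
    apply hRG
    have hyG : y ∈ G := by
      have := G.sub_mem hin hg'G
      simpa using this
    -- then y = ρ_M y ∈ Ḡ_M and R = z + y ∈ Ḡ_M
    have hyR : y ∈ restrictGauge G M := ⟨y, hyG, proj_eq_self_of_mem hyM⟩
    exact (restrictGauge G M).add_mem ⟨∑ a, c a • γ a, hg, hgz⟩ hyR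
  · -- support of y + g' ⊆ supp(z + y) ∪ B
    intro i hi
    rw [mem_filter, not_and_or] at hi
    rcases hi with hi | hi
    · exact absurd (mem_univ i) hi
    push Not at hi
    obtain ⟨⟨h1, h2⟩, hiB⟩ := hi
    by_cases hiM : i ∈ M
    · -- on M: g' agrees with z = ρ_M g'
      have hz1 : z.1 i = g'.1 i := by rw [← hzg']; simp [hiM]
      have hz2 : z.2 i = g'.2 i := by rw [← hzg']; simp [hiM]
      simp only [Prod.fst_add, Prod.snd_add, Pi.add_apply] at h1 h2 ⊢
      constructor
      · rw [← hz1, add_comm]; exact h1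
      · rw [← hz2, add_comm]; exact h2
    · -- off M and off B: y and g' vanish
      have hy0 := hyM i hiM
      have hg0 := hg'supp i (by rw [mem_union, not_or]; exact ⟨hiM, hiB⟩)
      simp only [Prod.fst_add, Prod.snd_add, Pi.add_apply, hy0.1, hy0.2, hg0.1, hg0.2, add_zero, and_self]

/-! ### Strips along the first coordinate -/

section Strips

variable {D' L : ℕ} (e : Fin n ≃ (Fin (D' + 1) → Fin L))

/-- The **strip** of the `m` consecutive columns `a, …, a + m − 1` (first coordinate) times everything.
Column: definition. [cite: BravyiTerhal2009, §3.1 proof of Thm. 3 («the minimal width strips M of height L»)] -/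
def strip (a m : ℕ) : Finset (Fin n) := univ.filter fun q => a ≤ (e q 0 : ℕ) ∧ (e q 0 : ℕ) < a + m

variable {e}

/-- Membership in a strip. [cite: BravyiTerhal2009, §3.1 proof of Thm. 3] -/
@[simp] theorem mem_strip {a m : ℕ} {q : Fin n} : q ∈ strip e a m ↔ a ≤ (e q 0 : ℕ) ∧ (e q 0 : ℕ) < a + m := by
  simp [strip]

/-- A strip of `m` columns has at most `m · L^{D−1}` qubits. [cite: BravyiTerhal2009, §2 proof of Thm. 1 («weight at most rL^{D−1}»)] -/
theorem card_strip_le (a m : ℕ) : #(strip e a m) ≤ m * L ^ D' := by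
  set C : Finset (Fin L) := univ.filter fun t : Fin L => a ≤ (t : ℕ) ∧ (t : ℕ) < a + m with hC
  have hs : strip e a m = (univ.filter fun x : Fin (D' + 1) → Fin L => x 0 ∈ C).map e.symm.toEmbedding := by
    ext q
    simp [strip, hC, Finset.mem_map_equiv]
  rw [hs, Finset.card_map, card_filter_apply_zero_mem]
  refine Nat.mul_le_mul_right _ ?_
  calc #C ≤ #(Finset.Ico a (a + m)) := by
        refine card_le_card_of_injOn (fun t : Fin L => (t : ℕ)) (fun t ht => ?_) ?_
        · have ht' := (mem_filter.1 (mem_coe.1 ht)).2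
          simpa [Finset.mem_Ico] using ht'
        · intro t₁ _ t₂ _ h
          exact Fin.ext h
    _ = m := by simp

/-- The strip of all columns is the whole lattice. [cite: BravyiTerhal2009, §3.1 proof of Thm. 3] -/
theorem strip_zero_eq_univ {m : ℕ} (hm : L ≤ m) : strip e 0 m = univ := by
  ext q
  simp only [mem_strip, zero_le, true_and, zero_add, mem_univ, iff_true]
  exact lt_of_lt_of_le (e q 0).isLt hm

end Strips

/-! ### Small symplectic helpers -/

/-- Additivity of the symplectic product in the second argument. [folklore] -/
private theorem sympInner_add_right' (u v w : SympVec n) : sympInner u (v + w) = sympInner u v + sympInner u w := by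
  rw [sympInner_comm, sympInner_add_left, sympInner_comm v, sympInner_comm w]

/-- Support bookkeeping: supported on `X` and on `Y` implies supported on any `Z ⊇ X ∩ Y`. [folklore] -/
private theorem mem_supportedOn_of_inter {X Y Z : Finset (Fin n)} {v : SympVec n} (hX : v ∈ supportedOn X)
    (hY : v ∈ supportedOn Y) (h : ∀ i, i ∈ X → i ∈ Y → i ∈ Z) : v ∈ supportedOn Z := by
  intro i hi
  by_cases hiX : i ∈ X
  · by_cases hiY : i ∈ Y
    · exact absurd (h i hiX hiY) hi
    · exact hY i hiY
  · exact hX i hiX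

end GaugeRestrict

open GaugeRestrict

/-! ### Theorem 3 -/

/-- **Bravyi–Terhal 2009, Theorem 3 — proved** (open boundary conditions, every `D ≥ 1` and `L`). «Let
`𝒢 = ⟨G_1,…,G_m⟩` be the gauge group of a subsystem stabilizer code on a `D`-dimensional lattice `Λ = {1,…,L}^D`.
Suppose the support of any generator `G_a` can be bounded by a hypercube with `r^D` vertices. Then the distance of `𝒢`
satisfies `d ≤ 3r L^{D−1}`.» Typed: for every gauge space `Ḡ` spanned by its elements each covered by a hypercube with
`r^D` vertices (`r ≥ 1`), with `k ≥ 1` logical qubits and no dressed logical operator of weight `< d`: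
`d ≤ 3 r L^{D−1}` (the stabilizer group may be non-local, as for the Bacon–Shor code). Column: proved theorem.
-- TODO(general form): periodic boundary conditions.
[cite: BravyiTerhal2009, §1.3 Thm. 3 (p. 7) with §3.1 Lemma 3 (Restriction Lemma) and the proof of Thm. 3 (pp. 11–12)] -/
theorem BravyiTerhal2009_theorem3 (D L r : ℕ) {k d : ℕ} (e : Fin n ≃ (Fin D → Fin L))
    (G : Submodule (ZMod 2) (SympVec n)) (hD : 1 ≤ D) (hr : 1 ≤ r) (hloc : HasLocalGenerators e r G)
    (hcode : IsSubsystemCode G k d) (hk : 1 ≤ k) : d ≤ 3 * r * L ^ (D - 1) := by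
  obtain ⟨D', rfl⟩ : ∃ D', D = D' + 1 := ⟨D - 1, by omega⟩
  rw [Nat.add_sub_cancel]
  -- the local gauge generators
  set T : Set (SympVec n) := {v | v ∈ G ∧ IsCubeLocal e r v} with hT
  haveI : Fintype T := Fintype.ofFinite T
  have hG : G = Submodule.span (ZMod 2) (Set.range (Subtype.val : T → SympVec n)) := by
    rw [Subtype.range_coe]
    exact le_antisymm hloc (Submodule.span_le.2 fun v hv => hv.1)
  have hγ : ∀ b : T, IsCubeLocal e r (b : SympVec n) := fun b => b.2.2
  -- minimal strip width carrying a logical pair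
  have hex : ∃ m, ∃ a, HasLogicalPairOn G (strip e a m) :=
    ⟨L, 0, by rw [strip_zero_eq_univ (le_refl L)]; exact hasLogicalPairOn_univ hcode hk⟩
  set m₀ := Nat.find hex with hm₀
  obtain ⟨a, hpair⟩ : ∃ a, HasLogicalPairOn G (strip e a m₀) := Nat.find_spec hex
  have hmin : ∀ m < m₀, ∀ a', ¬ HasLogicalPairOn G (strip e a' m) :=
    fun m hm a' h => Nat.find_min hex hm ⟨a', h⟩
  -- narrow minimal strip: d ≤ |M| ≤ r L^{D'}
  by_cases hsmall : m₀ ≤ r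
  · calc d ≤ #(strip e a m₀) := dist_le_card_of_pair hcode.2 hpair
      _ ≤ m₀ * L ^ D' := card_strip_le a m₀
      _ ≤ 3 * r * L ^ D' := Nat.mul_le_mul_right _ (by omega)
  rw [not_le] at hsmall
  -- M = A ∪ B ∪ C : A = column a, B = the next r − 1 columns, C = the remaining m₀ − r ≥ 1 columns
  set M : Finset (Fin n) := strip e a m₀ with hMdef
  set A : Finset (Fin n) := strip e a 1 with hAdef
  set B : Finset (Fin n) := strip e (a + 1) (r - 1) with hBdef
  set C : Finset (Fin n) := strip e (a + r) (m₀ - r) with hCdef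
  have hAM : A ⊆ M := fun q hq => by rw [hAdef, mem_strip] at hq; rw [hMdef, mem_strip]; omega
  have hCM : C ⊆ M := fun q hq => by rw [hCdef, mem_strip] at hq; rw [hMdef, mem_strip]; omega
  have hMBc : ∀ q, q ∈ M → q ∉ B → q ∈ A ∪ C := fun q hq hqB => by
    rw [hMdef, mem_strip] at hq
    rw [hBdef, mem_strip] at hqB
    rw [mem_union, hAdef, hCdef, mem_strip, mem_strip]
    omega
  set GM := restrictGauge G M with hGM
  by_cases hcase : ∃ R ∈ sympDual (gaugeStabilizer GM), R ∈ supportedOn B ∧ R ∉ GM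
  · -- (i) B carries a dressed logical operator of 𝒢_M: Restriction Lemma, d ≤ |B| + |∂M| ≤ 3(r−1) L^{D'}
    obtain ⟨R, hRd, hRB, hRG⟩ := hcase
    set Bd : Finset (Fin n) := strip e (a - (r - 1)) (r - 1) ∪ strip e (a + m₀) (r - 1) with hBd
    have hbd : ∀ b : T, (∃ q ∈ sympSupport (b : SympVec n), q ∈ M) →
        ∀ q ∈ sympSupport (b : SympVec n), q ∉ M → q ∈ Bd := by
      intro b ⟨q₁, hq₁, hq₁M⟩ q hq hqM
      obtain ⟨c, hc⟩ := hγ b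
      have h1 := (hc q₁ hq₁ 0)
      have h2 := (hc q hq 0)
      rw [hMdef, mem_strip] at hq₁M hqM
      rw [hBd, mem_union, mem_strip, mem_strip]
      omega
    have hRM : R ∈ supportedOn M := fun i hi => hRB i fun hiB => hi (by
      rw [hBdef, mem_strip] at hiB; rw [hMdef, mem_strip]; omega)
    obtain ⟨R', hR'd, hR'G, hR's⟩ :=
      exists_dressed_extension (Subtype.val : T → SympVec n) hG hbd hRM hRd hRG
    have hR'BBd : R' ∈ supportedOn (B ∪ Bd) := by
      intro i hi
      refine hR's i fun hi' => hi ?_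
      rw [mem_filter] at hi'
      rw [mem_union]
      rcases hi'.2 with h | h
      · left
        by_contra hiB
        have := hRB i hiB
        rcases h with h | h
        · exact h this.1
        · exact h this.2
      · exact Or.inr h
    calc d ≤ sympWeight R' := hcode.2 R' hR'd hR'G
      _ ≤ #(B ∪ Bd) := sympWeight_le_card_of_mem hR'BBd
      _ ≤ #B + #Bd := card_union_le _ _
      _ ≤ (r - 1) * L ^ D' + ((r - 1) * L ^ D' + (r - 1) * L ^ D') := by
          refine Nat.add_le_add (card_strip_le _ _) ((card_union_le _ _).trans ?_)
          exact Nat.add_le_add (card_strip_le _ _) (card_strip_le _ _)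
      _ = 3 * (r - 1) * L ^ D' := by ring
      _ ≤ 3 * r * L ^ D' := Nat.mul_le_mul_right _ (by omega)
  · -- (ii) B is correctable for 𝒢_M: clean the logical pair off B, split across the gap, contradict minimality
    push Not at hcase
    have hBcorr : IsGaugeCorrectable GM B := fun R hR hRB => hcase R hR hRB
    have hclean := sup_gaugeStabilizer_bare_compl_eq hBcorr
    obtain ⟨P, hPd, hPM, Q, hQd, hQM, hPQ⟩ := hpair
    have hPd' : P ∈ sympDual GM := (mem_sympDual_restrictGauge_iff hPM).2 hPd
    have hQd' : Q ∈ sympDual GM := (mem_sympDual_restrictGauge_iff hQM).2 hQd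
    have hP2 : P ∈ gaugeStabilizer GM ⊔ (sympDual GM ⊓ supportedOn Bᶜ) := by rw [hclean]; exact hPd'
    have hQ2 : Q ∈ gaugeStabilizer GM ⊔ (sympDual GM ⊓ supportedOn Bᶜ) := by rw [hclean]; exact hQd'
    obtain ⟨s₁, hs₁, P', ⟨hP'd, hP'B⟩, rfl⟩ := Submodule.mem_sup.1 hP2
    obtain ⟨s₂, hs₂, Q', ⟨hQ'd, hQ'B⟩, rfl⟩ := Submodule.mem_sup.1 hQ2
    -- the cleaned pair still anticommutes
    have hS'le : gaugeStabilizer GM ≤ GM := gaugeStabilizer_le GM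
    have h11 : sympInner s₁ s₂ = 0 := by
      have := (mem_sympDual_iff.1 (isSelfOrthogonal_gaugeStabilizer GM hs₂)) s₁ hs₁
      exact this
    have h12 : sympInner s₁ Q' = 0 := (mem_sympDual_iff.1 hQ'd) s₁ (hS'le hs₁)
    have h21 : sympInner P' s₂ = 0 := by
      rw [sympInner_comm]; exact (mem_sympDual_iff.1 hP'd) s₂ (hS'le hs₂)
    have hP'Q' : sympInner P' Q' ≠ 0 := by
      intro h0
      apply hPQ
      rw [sympInner_add_left, sympInner_add_right', sympInner_add_right', h11, h12, h21, h0]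
      simp
    -- P', Q' live on M ∖ B ⊆ A ∪ C
    have hs₁M : s₁ ∈ supportedOn M := restrictGauge_le_supportedOn (hS'le hs₁)
    have hs₂M : s₂ ∈ supportedOn M := restrictGauge_le_supportedOn (hS'le hs₂)
    have hP'M : P' ∈ supportedOn M := by
      have := (supportedOn M).sub_mem hPM hs₁M; simpa using this
    have hQ'M : Q' ∈ supportedOn M := by
      have := (supportedOn M).sub_mem hQM hs₂M; simpa using this
    have hP'AC : P' ∈ supportedOn (A ∪ C) :=
      mem_supportedOn_of_inter hP'M hP'B fun i hiM hiB => hMBc i hiM (by simpa using hiB)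
    have hQ'AC : Q' ∈ supportedOn (A ∪ C) :=
      mem_supportedOn_of_inter hQ'M hQ'B fun i hiM hiB => hMBc i hiM (by simpa using hiB)
    -- bare for Ḡ
    have hP'G : P' ∈ sympDual G := (mem_sympDual_restrictGauge_iff hP'M).1 hP'd
    have hQ'G : Q' ∈ sympDual G := (mem_sympDual_restrictGauge_iff hQ'M).1 hQ'd
    -- split across the gap B: X_A = ρ_A X, X_C = ρ_{Ā} X ∈ 𝒫(C)
    have hsplitC : ∀ {X : SympVec n}, X ∈ supportedOn (A ∪ C) → proj Aᶜ X ∈ supportedOn C := by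
      intro X hX
      refine mem_supportedOn_of_inter (proj_mem_supportedOn_of_mem Aᶜ hX) (proj_mem_supportedOn Aᶜ X)
        fun i hiAC hiAc => ?_
      rw [mem_union] at hiAC
      rw [mem_compl] at hiAc
      exact hiAC.resolve_left hiAc
    -- a generator meeting A misses C and vice versa (the gap B has r − 1 columns)
    have hgapA : ∀ b : T, (∃ q ∈ sympSupport (b : SympVec n), q ∈ A) →
        (b : SympVec n) ∈ supportedOn Cᶜ := by
      intro b ⟨q₁, hq₁, hq₁A⟩
      obtain ⟨c, hc⟩ := hγ b
      have h1 := hc q₁ hq₁ 0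
      rw [hAdef, mem_strip] at hq₁A
      refine mem_supportedOn_of_forall_sympSupport fun q hq => ?_
      have h2 := hc q hq 0
      rw [mem_compl, hCdef, mem_strip]
      omega
    have hgapC : ∀ b : T, (∃ q ∈ sympSupport (b : SympVec n), q ∈ C) →
        (b : SympVec n) ∈ supportedOn Aᶜ := by
      intro b ⟨q₁, hq₁, hq₁C⟩
      obtain ⟨c, hc⟩ := hγ b
      have h1 := hc q₁ hq₁ 0
      rw [hCdef, mem_strip] at hq₁C
      refine mem_supportedOn_of_forall_sympSupport fun q hq => ?_
      have h2 := hc q hq 0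
      rw [mem_compl, hAdef, mem_strip]
      omega
    -- the pieces are bare logical operators of Ḡ
    have hpieceA : ∀ {X : SympVec n}, X ∈ sympDual G → X ∈ supportedOn (A ∪ C) → proj A X ∈ sympDual G := by
      intro X hXd hXAC
      rw [hG]
      refine mem_sympDual_span_of_forall _ fun b => ?_
      by_cases hmeet : ∃ q ∈ sympSupport (b : SympVec n), q ∈ A
      · have htot : sympInner (b : SympVec n) X = 0 :=
          (mem_sympDual_iff.1 hXd) _ (by rw [hG]; exact Submodule.subset_span ⟨b, rfl⟩)
        have hC0 : sympInner (b : SympVec n) (proj Aᶜ X) = 0 := by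
          rw [sympInner_comm]
          exact sympInner_eq_zero_of_supportedOn_compl (hsplitC hXAC) (by simpa using hgapA b hmeet)
        rw [← proj_add_proj_compl A X, sympInner_add_right', hC0, add_zero] at htot
        exact htot
      · push Not at hmeet
        have hb : (b : SympVec n) ∈ supportedOn Aᶜ :=
          mem_supportedOn_of_forall_sympSupport fun q hq => by simpa using hmeet q hq
        rw [sympInner_comm]
        exact sympInner_eq_zero_of_supportedOn_compl (proj_mem_supportedOn A X) hb
    have hpieceC : ∀ {X : SympVec n}, X ∈ sympDual G → X ∈ supportedOn (A ∪ C) → proj Aᶜ X ∈ sympDual G := by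
      intro X hXd hXAC
      rw [hG]
      refine mem_sympDual_span_of_forall _ fun b => ?_
      by_cases hmeet : ∃ q ∈ sympSupport (b : SympVec n), q ∈ C
      · have htot : sympInner (b : SympVec n) X = 0 :=
          (mem_sympDual_iff.1 hXd) _ (by rw [hG]; exact Submodule.subset_span ⟨b, rfl⟩)
        have hA0 : sympInner (b : SympVec n) (proj A X) = 0 := by
          rw [sympInner_comm]
          exact sympInner_eq_zero_of_supportedOn_compl (proj_mem_supportedOn A X) (hgapC b hmeet)
        rw [← proj_add_proj_compl A X, sympInner_add_right', hA0, zero_add] at htot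
        exact htot
      · push Not at hmeet
        have hb : (b : SympVec n) ∈ supportedOn Cᶜ :=
          mem_supportedOn_of_forall_sympSupport fun q hq => by simpa using hmeet q hq
        rw [sympInner_comm]
        exact sympInner_eq_zero_of_supportedOn_compl (hsplitC hXAC) (by simpa using hb)
    -- ⟨P', Q'⟩ = ⟨P_A, Q_A⟩ + ⟨P_C, Q_C⟩
    have hsum : sympInner P' Q' =
        sympInner (proj A P') (proj A Q') + sympInner (proj Aᶜ P') (proj Aᶜ Q') := by
      conv_lhs => rw [← proj_add_proj_compl A P', ← proj_add_proj_compl A Q']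
      rw [sympInner_add_left, sympInner_add_right', sympInner_add_right',
        sympInner_eq_zero_of_supportedOn_compl (proj_mem_supportedOn A P') (proj_mem_supportedOn Aᶜ Q'),
        sympInner_comm (proj Aᶜ P') (proj A Q'),
        sympInner_eq_zero_of_supportedOn_compl (proj_mem_supportedOn A Q') (proj_mem_supportedOn Aᶜ P')]
      abel
    by_cases hA0 : sympInner (proj A P') (proj A Q') ≠ 0
    · -- a logical pair on the single column A: contradicts minimality (1 < m₀)
      exact (hmin 1 (by omega) a ⟨proj A P', hpieceA hP'G hP'AC, proj_mem_supportedOn A P',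
        proj A Q', hpieceA hQ'G hQ'AC, proj_mem_supportedOn A Q', hA0⟩).elim
    · -- a logical pair on C (m₀ − r columns): contradicts minimality
      rw [not_not] at hA0
      have hC0 : sympInner (proj Aᶜ P') (proj Aᶜ Q') ≠ 0 := by
        intro h0; apply hP'Q'; rw [hsum, hA0, h0, add_zero]
      exact (hmin (m₀ - r) (by omega) (a + r) ⟨proj Aᶜ P', hpieceC hP'G hP'AC, hsplitC hP'AC,
        proj Aᶜ Q', hpieceC hQ'G hQ'AC, hsplitC hQ'AC, hC0⟩).elim



end Literature.InformationTheory.QuantumCodes
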